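import Mathlib
/-!
# The peeling reduction of the union row (every number of observed vertices)
(blind cell PercRepro2, mine-1 g41; paper proofs/MINE1-UNIONROW-K3.md §8)

For a finite set of cells `ι` (the status grid `{T<N<S}^F` for any finite `F`, or any finite type), masses `m : ι → ℝ`,
a cut set `D` and cell sets `A`, `B`, the grid row is
`rowV m D A B = Σ_{c ∉ D} m c (Z·1_A(c) − M(A)) (Z·1_B(c) − M(B))`, `Z = M(univ)`;
for the three-status grid with up-sets `A`, `B` and `D = {some x ∈ X has status S} ∩ {some y ∈ Y has status T}` it is
`Z²` times the union row `E[(1_A − E[1_A|Q])(1_B − E[1_B|Q]) 1_{Q ∩ ({s ↮ X} ∪ {t ↮ Y})}]` (MINE1-UNIONROW-THEOREM.md §2).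

Because `Z·1_A − M(A)` is linear in the indicator of `A`, removing one cell `g ∉ D` from `A` changes the row by an explicit
cubic (`rowV_sub_erase`): `m g · (Z²·1_B(g) − Z·M(B ∖ D) − M(B)·M(D))`. Hence, for nonnegative masses,
* (P1) `rowV_erase_le` — removing a cell `g ∈ A ∩ B`, `g ∉ D` from `A` does not increase the row;
* (P2) `rowV_insert_le` — adding a cell `h ∉ A ∪ B ∪ D` to `A` does not increase the row;
and their mirrors with `A` and `B` exchanged (`rowV_comm`). When `g` is a minimal cell of the up-set `A` (resp. `h` a maximal cell
of the down-set `Aᶜ`) the new set is again an up-set, so every instance of the union row reduces, by a chain of these moves,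
to a TERMINAL instance of no larger value — and only terminal instances need positive association (k = 2: they are trivial,
one-fact, or the (K) instance; k = 3: 193,662 of them, see the paper). No positive association is used here.
-/

namespace Summit.Ventures.PercRepro2.UnionRowPeel

open Finset

variable {ι : Type*} [Fintype ι] [DecidableEq ι]

/-- The mass `M(S) = Σ_{x ∈ S} m x` of a set of cells. -/
noncomputable def mass (m : ι → ℝ) (S : Finset ι) : ℝ := ∑ x ∈ S, m x

/-- The indicator `1_S(c)` as a real number. -/
noncomputable def ind (S : Finset ι) (c : ι) : ℝ := if c ∈ S then 1 else 0

/-- The grid row `V(A,B) = Σ_{c ∉ D} m c (Z·1_A(c) − M(A)) (Z·1_B(c) − M(B))`, `Z = M(univ)`. -/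
noncomputable def rowV (m : ι → ℝ) (D A B : Finset ι) : ℝ :=
  ∑ c ∈ univ \ D, m c * (mass m univ * ind A c - mass m A) * (mass m univ * ind B c - mass m B)

/-- The row is symmetric in `A` and `B`. -/
theorem rowV_comm (m : ι → ℝ) (D A B : Finset ι) : rowV m D A B = rowV m D B A := by
  unfold rowV
  refine sum_congr rfl fun c _ => ?_
  ring

omit [Fintype ι] [DecidableEq ι] in
/-- Masses are nonnegative for nonnegative `m`. -/
theorem mass_nonneg {m : ι → ℝ} (hm : ∀ x, 0 ≤ m x) (S : Finset ι) : 0 ≤ mass m S :=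
  sum_nonneg fun x _ => hm x

omit [Fintype ι] [DecidableEq ι] in
/-- Monotonicity of the mass under inclusion (nonnegative `m`). -/
theorem mass_mono {m : ι → ℝ} (hm : ∀ x, 0 ≤ m x) {S T : Finset ι} (h : S ⊆ T) : mass m S ≤ mass m T :=
  sum_le_sum_of_subset_of_nonneg h fun x _ _ => hm x

omit [Fintype ι] in
/-- `M(T ∖ S) + M(S) = M(T)` for `S ⊆ T`. -/
theorem mass_sdiff_add (m : ι → ℝ) {S T : Finset ι} (h : S ⊆ T) : mass m (T \ S) + mass m S = mass m T :=
  sum_sdiff h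

omit [Fintype ι] in
/-- `M(A ∖ {g}) = M(A) − m g` for `g ∈ A`. -/
theorem mass_erase (m : ι → ℝ) {A : Finset ι} {g : ι} (hg : g ∈ A) : mass m (A.erase g) = mass m A - m g :=
  sum_erase_eq_sub hg

omit [Fintype ι] in
/-- The indicator of `A ∖ {g}` for `g ∈ A`. -/
theorem ind_erase {A : Finset ι} {g : ι} (hg : g ∈ A) (c : ι) :
    ind (A.erase g) c = ind A c - (if c = g then 1 else 0) := by
  unfold ind
  by_cases hc : c = g
  · subst hc; simp [hg]
  · simp [hc]

/-- `Σ_{c ∉ D} m c · 1_B(c) = M(B ∖ D)`. -/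
theorem sum_ind_sdiff (m : ι → ℝ) (D B : Finset ι) :
    ∑ c ∈ univ \ D, m c * ind B c = mass m (B \ D) := by
  unfold mass ind
  have h1 : ∀ c ∈ univ \ D, m c * (if c ∈ B then (1:ℝ) else 0) = if c ∈ B then m c else 0 := by
    intro c _
    split_ifs <;> ring
  rw [sum_congr rfl h1, sum_ite_mem]
  congr 1
  ext c
  simp [mem_sdiff, mem_inter]
  tauto

/-- The difference of the row when one cell `g ∉ D` is removed from `A`:
`V(A,B) − V(A ∖ g, B) = m g · (Z²·1_B(g) − Z·M(B ∖ D) − M(B)·M(D))`. -/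
theorem rowV_sub_erase (m : ι → ℝ) (D A B : Finset ι) {g : ι} (hgA : g ∈ A) (hgD : g ∉ D) :
    rowV m D A B - rowV m D (A.erase g) B
      = m g * (mass m univ ^ 2 * ind B g - mass m univ * mass m (B \ D) - mass m B * mass m D) := by
  have hZ : mass m (univ \ D) = mass m univ - mass m D := by
    have := mass_sdiff_add m (subset_univ D); linarith
  have hsum : ∑ c ∈ univ \ D, m c * (mass m univ * ind B c - mass m B)
      = mass m univ * mass m (B \ D) - mass m B * (mass m univ - mass m D) := by
    have : ∀ c ∈ univ \ D, m c * (mass m univ * ind B c - mass m B)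
        = mass m univ * (m c * ind B c) - mass m B * m c := by intro c _; ring
    rw [sum_congr rfl this, sum_sub_distrib, ← mul_sum, ← mul_sum, sum_ind_sdiff, ← hZ]
    rfl
  have hg' : g ∈ univ \ D := by simp [hgD]
  have hpt : ∀ c ∈ univ \ D,
      m c * (mass m univ * ind A c - mass m A) * (mass m univ * ind B c - mass m B)
        - m c * (mass m univ * ind (A.erase g) c - mass m (A.erase g)) * (mass m univ * ind B c - mass m B)
      = (if c = g then mass m univ * m c * (mass m univ * ind B c - mass m B) else 0)
        - m g * (m c * (mass m univ * ind B c - mass m B)) := by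
    intro c _
    rw [ind_erase hgA, mass_erase m hgA]
    split_ifs <;> ring
  unfold rowV
  rw [← sum_sub_distrib, sum_congr rfl hpt, sum_sub_distrib, sum_ite_eq', if_pos hg', ← mul_sum, hsum]
  ring

/-- (P1) Removing a cell `g ∈ A ∩ B`, `g ∉ D`, from `A` does not increase the row (nonnegative masses). -/
theorem rowV_erase_le {m : ι → ℝ} (hm : ∀ x, 0 ≤ m x) (D A B : Finset ι) {g : ι}
    (hgA : g ∈ A) (hgB : g ∈ B) (hgD : g ∉ D) :
    rowV m D (A.erase g) B ≤ rowV m D A B := by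
  have hdiff := rowV_sub_erase m D A B hgA hgD
  have hB : ind B g = 1 := by unfold ind; simp [hgB]
  rw [hB] at hdiff
  -- masses: Z = M(B) + M(Bᶜ), M(B) = M(B ∖ D) + M(B ∩ D), M(D) = M(D ∖ B) + M(D ∩ B), M(D ∖ B) ≤ M(Bᶜ)
  have h1 := mass_sdiff_add m (subset_univ B)
  have h2 := mass_sdiff_add m (inter_subset_left (s₁ := B) (s₂ := D))
  have h3 := mass_sdiff_add m (inter_subset_left (s₁ := D) (s₂ := B))
  rw [sdiff_inter_self_left] at h2 h3
  have h4 : mass m (D \ B) ≤ mass m (univ \ B) := mass_mono hm (sdiff_subset_sdiff (subset_univ D) le_rfl)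
  have h5 : mass m (B ∩ D) = mass m (D ∩ B) := by rw [inter_comm]
  have hBc := mass_nonneg hm (univ \ B)
  have hBm := mass_nonneg hm B
  have hDB := mass_nonneg hm (D ∩ B)
  have hg := hm g
  have key : 0 ≤ mass m univ ^ 2 * 1 - mass m univ * mass m (B \ D) - mass m B * mass m D := by
    nlinarith [mul_nonneg hBm (sub_nonneg.2 h4), mul_nonneg hBc hBc, mul_nonneg hBc hDB]
  nlinarith [mul_nonneg hg key]

/-- (P2) Adding a cell `h ∉ A ∪ B ∪ D` to `A` does not increase the row (nonnegative masses). -/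
theorem rowV_insert_le {m : ι → ℝ} (hm : ∀ x, 0 ≤ m x) (D A B : Finset ι) {h : ι}
    (hhA : h ∉ A) (hhB : h ∉ B) (hhD : h ∉ D) :
    rowV m D (insert h A) B ≤ rowV m D A B := by
  have hdiff := rowV_sub_erase m D (insert h A) B (mem_insert_self h A) hhD
  rw [erase_insert hhA] at hdiff
  have hB : ind B h = 0 := by unfold ind; simp [hhB]
  rw [hB] at hdiff
  have hZ := mass_nonneg hm univ
  have hBD := mass_nonneg hm (B \ D)
  have hBm := mass_nonneg hm B
  have hD := mass_nonneg hm D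
  have hh := hm h
  nlinarith [mul_nonneg hh (mul_nonneg hZ hBD), mul_nonneg hh (mul_nonneg hBm hD)]

/-- (P1′) The mirror of (P1): removing `g ∈ A ∩ B`, `g ∉ D`, from `B`. -/
theorem rowV_erase_le' {m : ι → ℝ} (hm : ∀ x, 0 ≤ m x) (D A B : Finset ι) {g : ι}
    (hgA : g ∈ A) (hgB : g ∈ B) (hgD : g ∉ D) :
    rowV m D A (B.erase g) ≤ rowV m D A B := by
  rw [rowV_comm m D A (B.erase g), rowV_comm m D A B]
  exact rowV_erase_le hm D B A hgB hgA hgD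

/-- (P2′) The mirror of (P2): adding `h ∉ A ∪ B ∪ D` to `B`. -/
theorem rowV_insert_le' {m : ι → ℝ} (hm : ∀ x, 0 ≤ m x) (D A B : Finset ι) {h : ι}
    (hhA : h ∉ A) (hhB : h ∉ B) (hhD : h ∉ D) :
    rowV m D A (insert h B) ≤ rowV m D A B := by
  rw [rowV_comm m D A (insert h B), rowV_comm m D A B]
  exact rowV_insert_le hm D B A hhB hhA hhD

end Summit.Ventures.PercRepro2.UnionRowPeel
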